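import Mathlib
import Summits.ResolutionOfSingularities.ResolutionOfSingularities.Theorems.WeightedInvariantLocalWeightedDropNCResPresentationDefs
import Summits.ResolutionOfSingularities.ResolutionOfSingularities.Theorems.WeightedInvariantLocalWeightedDropPolyDescentSelNoChain
import Summits.ResolutionOfSingularities.ResolutionOfSingularities.Theorems.WeightedInvariantLocalWeightedDropNCResPhaseAssembly

/-!
# `LocalWeightedDrop`, TOT2-LINE inner S-ASM (5): REGIME (P) ASSEMBLED FROM ITS PIECES — the polyhedron play Σ**_d with boundary and conflicts,
# measure `(conflict budget, polyhedron rank)` lexicographic, projected to decorated states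

Crux item stmt-ResolutionOfSingularities-8899 `WeightedInvariant.LocalWeightedDrop` (route `ResolutionOfSingularities/WeightedInvariant`), ENGINE
skeleton v33 (35b29332b4d99231), registered stub **`stub_regimePresented`**; TOT2-LINE v1.3 §3 (P4) (`L/res-L1-w43-lead-1/g5/TOT2-LINE-v1.3.md`).
[OURS · L1 W4.3 · chain w43 · seat res-L1-w43-lead-1 gen 5 (the lead's assembly); def-free over part (4)'s interfaces; the PIECES are hypotheses
named after their hands: (P1) ENTRY and (P2)/(P2c) DECORATED STEPS = res-L1-w43-stub-2 (δ-adapter), (Px) EXIT READING, (P3) CONFLICT BUDGET =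
res-type-088 (`M` with its two laws, selector-generic), ρ-T in selector form = stub-2's `PolyDescent.wellFounded_polyRelSel` (p-landed
…PolyDescentSelNoChain), the decorated calculus `DWinsTo.of_wfMeasure` / `DWinsTo.map` = res-L1-w43-stub-1 (…NCResPhaseAssembly).  MODEL:
Cossart–Jannsen–Saito LNM 2270 Thm 5.40 with the B-permissibility detours of §5 Steps 3–7; nothing here is a statement of any manuscript; AI-produced,
gate-checked, weaker than expert review.]

THE PLAY.  Rich states `((b, δ), (A, N))`: an admissibly decorated position with the head of the phase, PRESENTED (`Decoration.PresBy δ d A N Θ` for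
some `Θ`) by a regime label `A` (`InPoly d A`) with `u`-boundary `N`.  Off the conflict states the mover plays the move of the selector strategy
`succTSel d ψsel` read through the presentation ((P2): every answer is a head drop, or the same head in the apex column, or presented by the family
successor `SuccFamilySel`, whose label is a strategy successor — polyhedron rank drops (ρ-T) and the budget does not rise (P3)); at a conflict state
the point move ((P2c): answers presented by `PointFamilySel` — the budget DROPS (P3)).  A presented successor outside the regime is in the apex
column (Px).  Measure `Λ·M + polyRank` (the lexicographic pair as one ordinal, `Λ` above every rank); `DWinsTo.of_measure`, then `DWinsTo.map Prod.fst`.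
* **`regimePresented_of_pieces`** — the registered stub's statement at a fixed field from the pieces;
* **`stub_regimePresented_of_pieces`** — under the stub's binders `∀ p prime, ∀ k, [Field k] [CharP k p] [IsAlgClosed k]`.
-/

set_option linter.dupNamespace false -- mandated namespace of this single-conjunct summit

noncomputable section

namespace Summit.ResolutionOfSingularities.ResolutionOfSingularities.Theorems

namespace TameFourTupleDrop

open MvPowerSeries Literature.AlgebraicGeometry.Resolution PolyDescent

variable {k : Type} [Field k]

/-- **REGIME (P) FROM ITS PIECES** (three letters, a field with infinitely many elements).  Hypotheses: a selector `ψsel` of preparing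
re-centrings (`hsel`); a conflict budget `M` that the selector strategy's family successors do not raise between presented regime labels (`hM_succ`)
and that the point family lowers at conflict states (`hM_conf`); (P1) entry; (Px) exit reading; (P2) the decorated strategy step off the conflict;
(P2c) the decorated point step at a conflict.  Conclusion: the statement of `stub_regimePresented` at this field. -/
theorem regimePresented_of_pieces [Infinite k]
    (ψsel : (d : ℕ) → (Fin d → MvPowerSeries (Fin 2) k) → MvPowerSeries (Fin 2) k)
    (hsel : ∀ (d : ℕ) (X : Fin d → MvPowerSeries (Fin 2) k), IsPosT d X → IsPrepRecentring d X (ψsel d X))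
    (M : (d : ℕ) → (Fin d → MvPowerSeries (Fin 2) k) → Finset (Fin 2) → ℕ)
    (hM_succ : ∀ (d : ℕ) (A : Fin d → MvPowerSeries (Fin 2) k) (N : Finset (Fin 2)) (A' : Fin d → MvPowerSeries (Fin 2) k)
      (N' : Finset (Fin 2)),
      (∃ (b : MvPowerSeries (Fin (2 + 1)) k) (δ : Decoration k 2) (Θ : Fin (2 + 1) → MvPowerSeries (Fin (2 + 1)) k),
        Admissible b δ ∧ 2 ≤ δ.o ∧ δ.c = d ∧ δ.PresBy d A N Θ) →
      InPoly d A → InPoly d A' → SuccFamilySel d (ψsel d) A N A' N' → M d A' N' ≤ M d A N)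
    (hM_conf : ∀ (d : ℕ) (A : Fin d → MvPowerSeries (Fin 2) k) (N : Finset (Fin 2)) (A' : Fin d → MvPowerSeries (Fin 2) k)
      (N' : Finset (Fin 2)),
      (∃ (b : MvPowerSeries (Fin (2 + 1)) k) (δ : Decoration k 2) (Θ : Fin (2 + 1) → MvPowerSeries (Fin (2 + 1)) k),
        Admissible b δ ∧ 2 ≤ δ.o ∧ δ.c = d ∧ δ.PresBy d A N Θ) →
      InPoly d A → InPoly d A' → NCPoly.Conflict d A N → PointFamilySel d (ψsel d) A N A' N' → M d A' N' < M d A N)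
    (hP1 : ∀ (b : MvPowerSeries (Fin (2 + 1)) k) (δ : Decoration k 2), Admissible b δ → 2 ≤ δ.o → ¬ δ.HCol →
      (δ.O.Nonempty ∨ δ.GoodDir) →
      ∃ (A : Fin δ.c → MvPowerSeries (Fin 2) k) (N : Finset (Fin 2)) (Θ : Fin (2 + 1) → MvPowerSeries (Fin (2 + 1)) k),
        δ.PresBy δ.c A N Θ ∧ InPoly δ.c A)
    (hPx : ∀ (b : MvPowerSeries (Fin (2 + 1)) k) (δ : Decoration k 2) (d : ℕ) (A : Fin d → MvPowerSeries (Fin 2) k) (N : Finset (Fin 2))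
      (Θ : Fin (2 + 1) → MvPowerSeries (Fin (2 + 1)) k),
      Admissible b δ → 2 ≤ δ.o → δ.c = d → δ.PresBy d A N Θ → WellPrepared d A → ¬ InPoly d A → δ.HCol)
    (hP2 : ∀ (b : MvPowerSeries (Fin (2 + 1)) k) (δ : Decoration k 2) (d : ℕ) (A : Fin d → MvPowerSeries (Fin 2) k) (N : Finset (Fin 2))
      (Θ : Fin (2 + 1) → MvPowerSeries (Fin (2 + 1)) k),
      Admissible b δ → 2 ≤ δ.o → δ.c = d → δ.PresBy d A N Θ → InPoly d A → ¬ NCPoly.Conflict d A N →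
      ∃ (Φ : Fin (2 + 1) → MvPowerSeries (Fin (2 + 1)) k) (w : Fin (2 + 1) → ℕ), IsCountMove Φ w ∧
        MoveClause b Φ w (fun b' => ∃ δ' : Decoration k 2, Admissible b' δ' ∧ (δ'.head < δ.head ∨ (δ'.head = δ.head ∧ (δ'.HCol ∨
          ∃ (A' : Fin d → MvPowerSeries (Fin 2) k) (N' : Finset (Fin 2)) (Θ' : Fin (2 + 1) → MvPowerSeries (Fin (2 + 1)) k),
            δ'.PresBy d A' N' Θ' ∧ WellPrepared d A' ∧ SuccFamilySel d (ψsel d) A N A' N')))))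
    (hP2c : ∀ (b : MvPowerSeries (Fin (2 + 1)) k) (δ : Decoration k 2) (d : ℕ) (A : Fin d → MvPowerSeries (Fin 2) k) (N : Finset (Fin 2))
      (Θ : Fin (2 + 1) → MvPowerSeries (Fin (2 + 1)) k),
      Admissible b δ → 2 ≤ δ.o → δ.c = d → δ.PresBy d A N Θ → InPoly d A → NCPoly.Conflict d A N →
      ∃ (Φ : Fin (2 + 1) → MvPowerSeries (Fin (2 + 1)) k) (w : Fin (2 + 1) → ℕ), IsCountMove Φ w ∧
        MoveClause b Φ w (fun b' => ∃ δ' : Decoration k 2, Admissible b' δ' ∧ (δ'.head < δ.head ∨ (δ'.head = δ.head ∧ (δ'.HCol ∨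
          ∃ (A' : Fin d → MvPowerSeries (Fin 2) k) (N' : Finset (Fin 2)) (Θ' : Fin (2 + 1) → MvPowerSeries (Fin (2 + 1)) k),
            δ'.PresBy d A' N' Θ' ∧ WellPrepared d A' ∧ PointFamilySel d (ψsel d) A N A' N')))))
    (b : MvPowerSeries (Fin (2 + 1)) k) (δ : Decoration k 2) (hadm : Admissible b δ) (ho : 2 ≤ δ.o) (hnc : ¬ δ.HCol)
    (hreg : δ.O.Nonempty ∨ δ.GoodDir) :
    DWinsTo (St := MvPowerSeries (Fin (2 + 1)) k × Decoration k 2) Prod.fst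
      (fun τ => Admissible τ.1 τ.2 ∧ (τ.2.head < δ.head ∨ (τ.2.head = δ.head ∧ τ.2.HCol))) (b, δ) := by
  classical
  -- the degree of the phase and the entry presentation
  set d : ℕ := δ.c with hd_def
  have hd : 0 < d := by rw [hd_def, Decoration.c]; omega
  obtain ⟨A₀, N₀, Θ₀, hpres₀, hin₀⟩ := hP1 b δ hadm ho hnc hreg
  -- rich states: decorated position + (label, boundary)
  let St : Type := (MvPowerSeries (Fin (2 + 1)) k × Decoration k 2) × ((Fin d → MvPowerSeries (Fin 2) k) × Finset (Fin 2))
  let germ : St → MvPowerSeries (Fin (2 + 1)) k := fun σ => σ.1.1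
  let Q : St → Prop := fun σ => Admissible σ.1.1 σ.1.2 ∧ (σ.1.2.head < δ.head ∨ (σ.1.2.head = δ.head ∧ σ.1.2.HCol))
  let C : Set St := {σ | Admissible σ.1.1 σ.1.2 ∧ σ.1.2.head = δ.head ∧
    (∃ Θ : Fin (2 + 1) → MvPowerSeries (Fin (2 + 1)) k, σ.1.2.PresBy d σ.2.1 σ.2.2 Θ) ∧ InPoly d σ.2.1}
  -- measure: `Λ·M + polyhedron rank`, with `Λ` strictly above every rank (the lexicographic pair `(M, rank)` as one ordinal)
  let rk : (Fin d → MvPowerSeries (Fin 2) k) → Ordinal.{0} := fun A => ((wellFounded_polyRelSel (k := k) hd (hsel d)).apply A).rank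
  let Λ : Ordinal.{0} := (⨆ A, rk A) + 1
  have hΛ : ∀ A, rk A < Λ := fun A => Order.lt_add_one_iff.mpr (le_ciSup (Ordinal.bddAbove_of_small (s := Set.range rk)) A)
  let μ : St → Ordinal.{0} := fun σ => Λ * (M d σ.2.1 σ.2.2 : Ordinal.{0}) + rk σ.2.1
  have hlex : ∀ (m m' : ℕ) (A A' : Fin d → MvPowerSeries (Fin 2) k), m' < m ∨ (m' = m ∧ rk A' < rk A) →
      Λ * (m' : Ordinal.{0}) + rk A' < Λ * (m : Ordinal.{0}) + rk A := by
    rintro m m' A A' (hm | ⟨rfl, hr⟩)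
    · have hm' : ((m' + 1 : ℕ) : Ordinal.{0}) ≤ (m : Ordinal.{0}) := Nat.cast_le.mpr (Nat.succ_le_of_lt hm)
      calc Λ * (m' : Ordinal.{0}) + rk A' < Λ * (m' : Ordinal.{0}) + Λ := by
            gcongr
            exact hΛ A'
        _ = Λ * ((m' + 1 : ℕ) : Ordinal.{0}) := by rw [Nat.cast_succ, mul_add_one]
        _ ≤ Λ * (m : Ordinal.{0}) := by gcongr
        _ ≤ Λ * (m : Ordinal.{0}) + rk A := le_self_add
    · gcongr
  -- head bookkeeping: a state of the phase has the same `o` and `c`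
  have hoc : ∀ δ' : Decoration k 2, δ'.head = δ.head → δ'.o = δ.o ∧ δ'.c = d := by
    intro δ' h
    rw [Decoration.head, Decoration.head, toLex_inj, Prod.ext_iff] at h
    exact ⟨h.1, h.2⟩
  have hσ₀ : (((b, δ), (A₀, N₀)) : St) ∈ C := ⟨hadm, rfl, ⟨Θ₀, hpres₀⟩, hin₀⟩
  have hwin : DWinsTo germ Q (((b, δ), (A₀, N₀)) : St) := by
    refine DWinsTo.of_measure C μ ?_ hσ₀
    rintro ⟨⟨b₁, δ₁⟩, ⟨A₁, N₁⟩⟩ ⟨hadm₁, hhead₁, ⟨Θ₁, hpres₁⟩, hin₁⟩ -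
    obtain ⟨ho₁, hc₁⟩ := hoc δ₁ hhead₁
    have ho₁' : 2 ≤ δ₁.o := by rw [ho₁]; exact ho
    have hctx : ∃ (b : MvPowerSeries (Fin (2 + 1)) k) (δ : Decoration k 2) (Θ : Fin (2 + 1) → MvPowerSeries (Fin (2 + 1)) k),
        Admissible b δ ∧ 2 ≤ δ.o ∧ δ.c = d ∧ δ.PresBy d A₁ N₁ Θ := ⟨b₁, δ₁, Θ₁, hadm₁, ho₁', hc₁, hpres₁⟩
    -- reading a presented successor with the same head: regime label (continue) or apex column (exit)
    have hread : ∀ (b' : MvPowerSeries (Fin (2 + 1)) k) (δ' : Decoration k 2), Admissible b' δ' → δ'.head = δ.head →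
        ∀ (A' : Fin d → MvPowerSeries (Fin 2) k) (N' : Finset (Fin 2)) (Θ' : Fin (2 + 1) → MvPowerSeries (Fin (2 + 1)) k),
        δ'.PresBy d A' N' Θ' → WellPrepared d A' →
        (M d A' N' < M d A₁ N₁ ∨ (M d A' N' = M d A₁ N₁ ∧ rk A' < rk A₁) ∨ ¬ InPoly d A') →
        ∃ τ' : St, germ τ' = b' ∧ (Q τ' ∨ (τ' ∈ C ∧ μ τ' < μ ((b₁, δ₁), (A₁, N₁)))) := by
      intro b' δ' hadm' hhead' A' N' Θ' hpres' hWP' halt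
      obtain ⟨ho', hc'⟩ := hoc δ' hhead'
      by_cases hin' : InPoly d A'
      · rcases halt with hlt | hlt | hnin
        · exact ⟨((b', δ'), (A', N')), rfl, Or.inr ⟨⟨hadm', hhead', ⟨Θ', hpres'⟩, hin'⟩, hlex _ _ _ _ (Or.inl hlt)⟩⟩
        · exact ⟨((b', δ'), (A', N')), rfl, Or.inr ⟨⟨hadm', hhead', ⟨Θ', hpres'⟩, hin'⟩, hlex _ _ _ _ (Or.inr hlt)⟩⟩
        · exact absurd hin' hnin
      · have hcol' : δ'.HCol := hPx b' δ' d A' N' Θ' hadm' (by rw [ho']; exact ho) hc' hpres' hWP' hin'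
        exact ⟨((b', δ'), (A', N')), rfl, Or.inl ⟨hadm', Or.inr ⟨hhead', hcol'⟩⟩⟩
    by_cases hconf : NCPoly.Conflict d A₁ N₁
    · -- the point move at a conflict: the budget drops
      obtain ⟨Φ, w, hmv, hcl⟩ := hP2c b₁ δ₁ d A₁ N₁ Θ₁ hadm₁ ho₁' hc₁ hpres₁ hin₁ hconf
      refine ⟨Φ, w, hmv, hcl.mono fun b' hb' => ?_⟩
      obtain ⟨δ', hadm', hcase⟩ := hb'
      rcases hcase with hlt | ⟨hhead', hcol' | ⟨A', N', Θ', hpres', hWP', hfam⟩⟩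
      · exact ⟨((b', δ'), (A₁, N₁)), rfl, Or.inl ⟨hadm', Or.inl (hhead₁ ▸ hlt)⟩⟩
      · exact ⟨((b', δ'), (A₁, N₁)), rfl, Or.inl ⟨hadm', Or.inr ⟨hhead'.trans hhead₁, hcol'⟩⟩⟩
      · refine hread b' δ' hadm' (hhead'.trans hhead₁) A' N' Θ' hpres' hWP' ?_
        by_cases hin' : InPoly d A'
        · exact Or.inl (hM_conf d A₁ N₁ A' N' hctx hin₁ hin' hconf hfam)
        · exact Or.inr (Or.inr hin')
    · -- the strategy move off the conflict: budget does not rise, polyhedron rank drops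
      obtain ⟨Φ, w, hmv, hcl⟩ := hP2 b₁ δ₁ d A₁ N₁ Θ₁ hadm₁ ho₁' hc₁ hpres₁ hin₁ hconf
      refine ⟨Φ, w, hmv, hcl.mono fun b' hb' => ?_⟩
      obtain ⟨δ', hadm', hcase⟩ := hb'
      rcases hcase with hlt | ⟨hhead', hcol' | ⟨A', N', Θ', hpres', hWP', hfam⟩⟩
      · exact ⟨((b', δ'), (A₁, N₁)), rfl, Or.inl ⟨hadm', Or.inl (hhead₁ ▸ hlt)⟩⟩
      · exact ⟨((b', δ'), (A₁, N₁)), rfl, Or.inl ⟨hadm', Or.inr ⟨hhead'.trans hhead₁, hcol'⟩⟩⟩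
      · refine hread b' δ' hadm' (hhead'.trans hhead₁) A' N' Θ' hpres' hWP' ?_
        by_cases hin' : InPoly d A'
        · have hM := hM_succ d A₁ N₁ A' N' hctx hin₁ hin' hfam
          have hrel : PolyRelSel d (ψsel d) A' A₁ := ⟨mem_succTSel_of_succFamilySel hfam, hin₁, hin'⟩
          have hrk : rk A' < rk A₁ := ((wellFounded_polyRelSel (k := k) hd (hsel d)).apply A₁).rank_lt_of_rel hrel
          rcases hM.lt_or_eq with hMlt | hMeq
          · exact Or.inl hMlt
          · exact Or.inr (Or.inl ⟨hMeq, hrk⟩)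
        · exact Or.inr (Or.inr hin')
  -- project to decorated states
  exact hwin.map (germ := Prod.fst) (germ' := germ) (Q' := Q)
    (Q := fun τ : MvPowerSeries (Fin (2 + 1)) k × Decoration k 2 => Admissible τ.1 τ.2 ∧ (τ.2.head < δ.head ∨ (τ.2.head = δ.head ∧ τ.2.HCol)))
    Prod.fst (fun _ => rfl) (fun _ hq => hq)

/-- **`stub_regimePresented` FROM ITS PIECES**, under the stub's binders `∀ p prime, ∀ k, [Field k] [CharP k p] [IsAlgClosed k]` (each piece taken under
the same binders). -/
theorem stub_regimePresented_of_pieces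
    (ψsel : ∀ (k : Type) [Field k] (d : ℕ), (Fin d → MvPowerSeries (Fin 2) k) → MvPowerSeries (Fin 2) k)
    (hsel : ∀ (p : ℕ), p.Prime → ∀ (k : Type) [Field k] [CharP k p] [IsAlgClosed k],
      ∀ (d : ℕ) (X : Fin d → MvPowerSeries (Fin 2) k), IsPosT d X → IsPrepRecentring d X (ψsel k d X))
    (M : ∀ (k : Type) [Field k] (d : ℕ), (Fin d → MvPowerSeries (Fin 2) k) → Finset (Fin 2) → ℕ)
    (hM_succ : ∀ (p : ℕ), p.Prime → ∀ (k : Type) [Field k] [CharP k p] [IsAlgClosed k],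
      ∀ (d : ℕ) (A : Fin d → MvPowerSeries (Fin 2) k) (N : Finset (Fin 2)) (A' : Fin d → MvPowerSeries (Fin 2) k) (N' : Finset (Fin 2)),
      (∃ (b : MvPowerSeries (Fin 3) k) (δ : Decoration k 2) (Θ : Fin 3 → MvPowerSeries (Fin 3) k),
        Admissible b δ ∧ 2 ≤ δ.o ∧ δ.c = d ∧ δ.PresBy d A N Θ) →
      InPoly d A → InPoly d A' → SuccFamilySel d (ψsel k d) A N A' N' → M k d A' N' ≤ M k d A N)
    (hM_conf : ∀ (p : ℕ), p.Prime → ∀ (k : Type) [Field k] [CharP k p] [IsAlgClosed k],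
      ∀ (d : ℕ) (A : Fin d → MvPowerSeries (Fin 2) k) (N : Finset (Fin 2)) (A' : Fin d → MvPowerSeries (Fin 2) k) (N' : Finset (Fin 2)),
      (∃ (b : MvPowerSeries (Fin 3) k) (δ : Decoration k 2) (Θ : Fin 3 → MvPowerSeries (Fin 3) k),
        Admissible b δ ∧ 2 ≤ δ.o ∧ δ.c = d ∧ δ.PresBy d A N Θ) →
      InPoly d A → InPoly d A' → NCPoly.Conflict d A N → PointFamilySel d (ψsel k d) A N A' N' → M k d A' N' < M k d A N)
    (hP1 : ∀ (p : ℕ), p.Prime → ∀ (k : Type) [Field k] [CharP k p] [IsAlgClosed k],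
      ∀ (b : MvPowerSeries (Fin 3) k) (δ : Decoration k 2), Admissible b δ → 2 ≤ δ.o → ¬ δ.HCol → (δ.O.Nonempty ∨ δ.GoodDir) →
      ∃ (A : Fin δ.c → MvPowerSeries (Fin 2) k) (N : Finset (Fin 2)) (Θ : Fin 3 → MvPowerSeries (Fin 3) k),
        δ.PresBy δ.c A N Θ ∧ InPoly δ.c A)
    (hPx : ∀ (p : ℕ), p.Prime → ∀ (k : Type) [Field k] [CharP k p] [IsAlgClosed k],
      ∀ (b : MvPowerSeries (Fin 3) k) (δ : Decoration k 2) (d : ℕ) (A : Fin d → MvPowerSeries (Fin 2) k) (N : Finset (Fin 2))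
      (Θ : Fin 3 → MvPowerSeries (Fin 3) k),
      Admissible b δ → 2 ≤ δ.o → δ.c = d → δ.PresBy d A N Θ → WellPrepared d A → ¬ InPoly d A → δ.HCol)
    (hP2 : ∀ (p : ℕ), p.Prime → ∀ (k : Type) [Field k] [CharP k p] [IsAlgClosed k],
      ∀ (b : MvPowerSeries (Fin 3) k) (δ : Decoration k 2) (d : ℕ) (A : Fin d → MvPowerSeries (Fin 2) k) (N : Finset (Fin 2))
      (Θ : Fin 3 → MvPowerSeries (Fin 3) k),
      Admissible b δ → 2 ≤ δ.o → δ.c = d → δ.PresBy d A N Θ → InPoly d A → ¬ NCPoly.Conflict d A N →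
      ∃ (Φ : Fin 3 → MvPowerSeries (Fin 3) k) (w : Fin 3 → ℕ), IsCountMove (m := 2) Φ w ∧
        MoveClause (m := 2) b Φ w (fun b' => ∃ δ' : Decoration k 2, Admissible b' δ' ∧ (δ'.head < δ.head ∨ (δ'.head = δ.head ∧ (δ'.HCol ∨
          ∃ (A' : Fin d → MvPowerSeries (Fin 2) k) (N' : Finset (Fin 2)) (Θ' : Fin 3 → MvPowerSeries (Fin 3) k),
            δ'.PresBy d A' N' Θ' ∧ WellPrepared d A' ∧ SuccFamilySel d (ψsel k d) A N A' N')))))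
    (hP2c : ∀ (p : ℕ), p.Prime → ∀ (k : Type) [Field k] [CharP k p] [IsAlgClosed k],
      ∀ (b : MvPowerSeries (Fin 3) k) (δ : Decoration k 2) (d : ℕ) (A : Fin d → MvPowerSeries (Fin 2) k) (N : Finset (Fin 2))
      (Θ : Fin 3 → MvPowerSeries (Fin 3) k),
      Admissible b δ → 2 ≤ δ.o → δ.c = d → δ.PresBy d A N Θ → InPoly d A → NCPoly.Conflict d A N →
      ∃ (Φ : Fin 3 → MvPowerSeries (Fin 3) k) (w : Fin 3 → ℕ), IsCountMove (m := 2) Φ w ∧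
        MoveClause (m := 2) b Φ w (fun b' => ∃ δ' : Decoration k 2, Admissible b' δ' ∧ (δ'.head < δ.head ∨ (δ'.head = δ.head ∧ (δ'.HCol ∨
          ∃ (A' : Fin d → MvPowerSeries (Fin 2) k) (N' : Finset (Fin 2)) (Θ' : Fin 3 → MvPowerSeries (Fin 3) k),
            δ'.PresBy d A' N' Θ' ∧ WellPrepared d A' ∧ PointFamilySel d (ψsel k d) A N A' N'))))) :
    ∀ (p : ℕ), p.Prime → ∀ (k : Type) [Field k] [CharP k p] [IsAlgClosed k],
      ∀ (b : MvPowerSeries (Fin 3) k) (δ : Decoration k 2), Admissible b δ → 2 ≤ δ.o → ¬ δ.HCol → (δ.O.Nonempty ∨ δ.GoodDir) →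
        DWinsTo (St := MvPowerSeries (Fin 3) k × Decoration k 2) Prod.fst
          (fun τ => Admissible τ.1 τ.2 ∧ (τ.2.head < δ.head ∨ (τ.2.head = δ.head ∧ τ.2.HCol))) (b, δ) :=
  fun p hp k _ _ _ b δ hadm ho hnc hreg =>
    regimePresented_of_pieces (ψsel k) (hsel p hp k) (M k) (hM_succ p hp k) (hM_conf p hp k) (hP1 p hp k) (hPx p hp k) (hP2 p hp k)
      (hP2c p hp k) b δ hadm ho hnc hreg

end TameFourTupleDrop

end Summit.ResolutionOfSingularities.ResolutionOfSingularities.Theorems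

end
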